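import Mathlib
import Literature.Computability.AlgebraicComplexity.StandardFamilies
import Literature.Computability.AlgebraicComplexity.DeterminantalConormalBound
import Summits.ValiantsHypothesis.ValiantsHypothesis.Theorems.RefutationDegreeDefs
import Summits.ValiantsHypothesis.ValiantsHypothesis.Theorems.RefutationDegreeRefutationBarrierSectionalTransfer

/-!
# Crux `RefutationBarrier` (stmt-ValiantsHypothesis-5642), line `Sketch_ideator5` (lead c2):
# the border transfer in arbitrary section variables, and the TOP RUNG (class of `P_n` itself)

`notInBorder_of_sectionalWitness` (file `…SectionalTransfer`) is stated for sections in the variables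
`Fin N` (the index type of the det-side theorems it consumes).  This file transports it along an
equivalence of index types (`polarSet`, the bordered Hessian and its determinant are equivariant under
renaming of variables), giving the same theorem for sections in any finite index type `σ` with
`|σ| ≥ 3` (`notInBorder_of_sectionalWitness_fintype`), and records the TOP RUNG used by the lead's
class-formula route to the research stub W: if, at one datum, `per_n` ITSELF (`n ≥ 2`, variables
`Fin n × Fin n`, no section) has more than `B(m, n²)` non-degenerate polar points — e.g. if the class of
the permanental hypersurface `P_n ⊂ ℙ^{n²-1}` exceeds `B(m, n²)` — then `per_n` is off the affine
border at size `m` (`notInBorder_of_classWitness`), i.e. `\overline{dc}_aff(per_n) > m`.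
-/

set_option linter.dupNamespace false

noncomputable section

namespace Summit.ValiantsHypothesis.ValiantsHypothesis.Theorems.RefutationDegree

open scoped BigOperators
open MvPolynomial Matrix
open Literature.Computability.AlgebraicComplexity (perPoly polarSet mem_polarSet conormalBezout)

/-- **Renaming variables preserves non-degenerate polar points.**  For an equivalence of index types
`e : σ ≃ τ`, a point `x` is a polar point of `g` at the datum `(a, b, c)` with invertible bordered
Hessian iff `x ∘ e⁻¹` is one of `rename e g` at `(a ∘ e⁻¹, b ∘ e⁻¹, c ∘ e⁻¹)` (only the direction
used below is stated). [folklore] -/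
theorem polar_nondegenerate_rename {σ τ : Type} [Fintype σ] [Fintype τ] [DecidableEq σ]
    [DecidableEq τ] (e : σ ≃ τ) (g : MvPolynomial σ ℂ) (a b c x : σ → ℂ)
    (hx : x ∈ polarSet g a b c)
    (hdet : (Matrix.fromBlocks
        (Matrix.of fun i j : σ => eval x (pderiv i (pderiv j g)))
        (Matrix.of fun (i : σ) (l : Fin 2) => ![a i, b i] l)
        (Matrix.of fun (l : Fin 2) (j : σ) => ![eval x (pderiv j g), c j] l)
        (0 : Matrix (Fin 2) (Fin 2) ℂ)).det ≠ 0) :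
    (x ∘ e.symm) ∈ polarSet (rename e g) (a ∘ e.symm) (b ∘ e.symm) (c ∘ e.symm) ∧
      (Matrix.fromBlocks
        (Matrix.of fun i j : τ => eval (x ∘ e.symm) (pderiv i (pderiv j (rename e g))))
        (Matrix.of fun (i : τ) (l : Fin 2) => ![(a ∘ e.symm) i, (b ∘ e.symm) i] l)
        (Matrix.of fun (l : Fin 2) (j : τ) => ![eval (x ∘ e.symm) (pderiv j (rename e g)),
          (c ∘ e.symm) j] l)
        (0 : Matrix (Fin 2) (Fin 2) ℂ)).det ≠ 0 := by
  classical
  -- evaluation and partial derivatives along the renaming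
  have hxe : (x ∘ e.symm) ∘ e = x := by
    funext i
    simp
  have hev : ∀ p : MvPolynomial σ ℂ, eval (x ∘ e.symm) (rename e p) = eval x p := by
    intro p
    rw [eval_rename, hxe]
  have hpd : ∀ (j : τ) (p : MvPolynomial σ ℂ),
      pderiv j (rename e p) = rename e (pderiv (e.symm j) p) := by
    intro j p
    conv_lhs => rw [← e.apply_symm_apply j]
    exact pderiv_rename e.injective _ _
  have hpd1 : ∀ j : τ, eval (x ∘ e.symm) (pderiv j (rename e g)) = eval x (pderiv (e.symm j) g) := by
    intro j
    rw [hpd, hev]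
  have hpd2 : ∀ i j : τ, eval (x ∘ e.symm) (pderiv i (pderiv j (rename e g))) =
      eval x (pderiv (e.symm i) (pderiv (e.symm j) g)) := by
    intro i j
    rw [hpd, hpd, hev]
  obtain ⟨hg0, ⟨i₀, hi₀⟩, ⟨s, t, hst⟩, hchart⟩ := hx
  refine ⟨mem_polarSet.2 ⟨?_, ⟨e i₀, ?_⟩, ⟨s, t, fun j => ?_⟩, ?_⟩, ?_⟩
  · rw [hev]; exact hg0
  · rw [hpd1, e.symm_apply_apply]; exact hi₀
  · rw [hpd1]; exact hst (e.symm j)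
  · have : ∑ j : τ, (c ∘ e.symm) j * (x ∘ e.symm) j = ∑ i : σ, c i * x i := by
      rw [← e.symm.sum_comp]
      rfl
    rw [this]; exact hchart
  · -- the new bordered Hessian is a reindexing of the old one
    set E : σ ⊕ Fin 2 ≃ τ ⊕ Fin 2 := e.sumCongr (Equiv.refl (Fin 2)) with hE
    have hM : (Matrix.fromBlocks
        (Matrix.of fun i j : τ => eval (x ∘ e.symm) (pderiv i (pderiv j (rename e g))))
        (Matrix.of fun (i : τ) (l : Fin 2) => ![(a ∘ e.symm) i, (b ∘ e.symm) i] l)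
        (Matrix.of fun (l : Fin 2) (j : τ) => ![eval (x ∘ e.symm) (pderiv j (rename e g)),
          (c ∘ e.symm) j] l)
        (0 : Matrix (Fin 2) (Fin 2) ℂ)) =
        Matrix.reindex E E (Matrix.fromBlocks
          (Matrix.of fun i j : σ => eval x (pderiv i (pderiv j g)))
          (Matrix.of fun (i : σ) (l : Fin 2) => ![a i, b i] l)
          (Matrix.of fun (l : Fin 2) (j : σ) => ![eval x (pderiv j g), c j] l)
          (0 : Matrix (Fin 2) (Fin 2) ℂ)) := by
      ext (i | l) (j | l')
      · simp [hE, Matrix.reindex_apply, hpd2]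
      · simp [hE, Matrix.reindex_apply]
      · simp [hE, Matrix.reindex_apply, hpd1]
      · simp [hE, Matrix.reindex_apply]
    rw [hM, Matrix.det_reindex_self]
    exact hdet

/-- **Border transfer, arbitrary section variables.**  `notInBorder_of_sectionalWitness` for linear
sections `per_n ∘ L` in any finite index type `σ` with `|σ| ≥ 3`: if `per_n` (`n ≤ m`) is in the
affine border at size `m`, no such section has, at any datum, more than `B(m, |σ|)` non-degenerate
polar points.  (Transport along `Fintype.equivFin σ`.) -/
theorem notInBorder_of_sectionalWitness_fintype {n m : ℕ} {σ : Type} [Fintype σ] [DecidableEq σ]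
    (hnm : n ≤ m) (hσ : 3 ≤ Fintype.card σ)
    (L : Fin n × Fin n → MvPolynomial σ ℂ) (hL : ∀ e, (L e).IsHomogeneous 1)
    (a b c : σ → ℂ) (F : Finset (σ → ℂ))
    (hF : ∀ x ∈ F, x ∈ polarSet (aeval L (perPoly (Fin n) ℂ)) a b c ∧
      (Matrix.fromBlocks
        (Matrix.of fun i j : σ => eval x (pderiv i (pderiv j (aeval L (perPoly (Fin n) ℂ)))))
        (Matrix.of fun (i : σ) (l : Fin 2) => ![a i, b i] l)
        (Matrix.of fun (l : Fin 2) (j : σ) =>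
          ![eval x (pderiv j (aeval L (perPoly (Fin n) ℂ))), c j] l)
        (0 : Matrix (Fin 2) (Fin 2) ℂ)).det ≠ 0)
    (hcard : conormalBezout m (Fintype.card σ) < F.card) : ¬ InBorder n m := by
  classical
  set e := Fintype.equivFin σ with he
  set L' : Fin n × Fin n → MvPolynomial (Fin (Fintype.card σ)) ℂ := fun i => rename e (L i) with hL'
  have hL'h : ∀ i, (L' i).IsHomogeneous 1 := fun i => (hL i).rename_isHomogeneous
  have hcomp : aeval L' (perPoly (Fin n) ℂ) = rename e (aeval L (perPoly (Fin n) ℂ)) := by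
    have h := comp_aeval (R := ℂ) (f := L) (rename e : MvPolynomial σ ℂ →ₐ[ℂ] _)
    have := AlgHom.congr_fun h (perPoly (Fin n) ℂ)
    simpa [hL'] using this.symm
  have hinj : Function.Injective fun x : σ → ℂ => x ∘ e.symm := by
    intro x x' h
    funext i
    have := congr_fun h (e i)
    simpa using this
  refine notInBorder_of_sectionalWitness (N := Fintype.card σ) hnm hσ L' hL'h (a ∘ e.symm)
    (b ∘ e.symm) (c ∘ e.symm) (F.image fun x => x ∘ e.symm) (fun x' hx' => ?_) ?_
  · obtain ⟨x, hx, rfl⟩ := Finset.mem_image.mp hx'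
    rw [hcomp]
    exact polar_nondegenerate_rename e _ a b c x (hF x hx).1 (hF x hx).2
  · rwa [Finset.card_image_of_injective _ hinj]

/-- **Top rung: a class-type witness for `per_n` itself puts it off the affine border.**  If for some
datum the permanent `per_n` (`2 ≤ n ≤ m`, in its own `n²` variables) has a finite set of more than
`B(m, n²)` non-degenerate polar points — in particular if the class of the permanental hypersurface
`P_n` exceeds `B(m, n²)`, all polar points at a generic datum being non-degenerate — then
`¬ InBorder n m`, i.e. `\overline{dc}_aff(per_n) > m`.  (The section `L = X` is the identity:
`aeval X per_n = per_n`.) -/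
theorem notInBorder_of_classWitness {n m : ℕ} (hn : 2 ≤ n) (hnm : n ≤ m)
    (a b c : Fin n × Fin n → ℂ) (F : Finset (Fin n × Fin n → ℂ))
    (hF : ∀ x ∈ F, x ∈ polarSet (perPoly (Fin n) ℂ) a b c ∧
      (Matrix.fromBlocks
        (Matrix.of fun i j : Fin n × Fin n => eval x (pderiv i (pderiv j (perPoly (Fin n) ℂ))))
        (Matrix.of fun (i : Fin n × Fin n) (l : Fin 2) => ![a i, b i] l)
        (Matrix.of fun (l : Fin 2) (j : Fin n × Fin n) =>
          ![eval x (pderiv j (perPoly (Fin n) ℂ)), c j] l)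
        (0 : Matrix (Fin 2) (Fin 2) ℂ)).det ≠ 0)
    (hcard : conormalBezout m (n * n) < F.card) : ¬ InBorder n m := by
  classical
  have hσ : 3 ≤ Fintype.card (Fin n × Fin n) := by
    simp only [Fintype.card_prod, Fintype.card_fin]
    nlinarith
  have hX : aeval (X : Fin n × Fin n → MvPolynomial (Fin n × Fin n) ℂ) (perPoly (Fin n) ℂ) =
      perPoly (Fin n) ℂ := aeval_X_left_apply _
  refine notInBorder_of_sectionalWitness_fintype hnm hσ X (fun i => isHomogeneous_X ℂ i) a b c F
    (fun x hx => ?_) (by simpa [Fintype.card_prod, Fintype.card_fin] using hcard)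
  rw [hX]
  exact hF x hx

end Summit.ValiantsHypothesis.ValiantsHypothesis.Theorems.RefutationDegree

end
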